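import Mathlib
import HarnessLib
import Literature.MathematicalPhysics.QuantumLattice.HubbardSpaceTimeCharacters
import Literature.MathematicalPhysics.QuantumLattice.SectorisedKernelNormExtraction
import Summits.HubbardSuperconductivity.HubbardSuperconductivity.Theorems.KLProgrammeKLRegimeTorusPairTransferKernel
import Summits.HubbardSuperconductivity.HubbardSuperconductivity.Theorems.KLProgrammeKLRegimeEngineTowerImportP2PlainFromValues

/-!
# Route `KLProgramme` — engine support (row (X).1 / #14 «S3 IN U-CURRENCY», NORM side, brick (T5b)): the position kernel of a Grassmann element whose quartic
# MOMENTUM kernel is CONSERVING and TRANSFER-ONLY is EXACTLY a pair-transfer form — the model dictionary for (T2)'s hypothesis `hB`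

Cell gate-hubbard-kl, seat hubbard-kl-k3c2-p3 (g16).  Sequel to `…TorusPairTransferKernel` ((T5a), the character identity) and companion of (T2)
`TorusFourierL2.fixedTupleL1_le_of_pairTransfer` (p704772).  For the Hubbard host (`SectorisedKernelNorm`: plane waves `e^{-is_c k·x}`, `sectorisedKernel`
with the trivial multiplier = the position kernels of BGM (2.17)) and the charge string `(+,+,−,−)` on the four legs:

* §1 `xbar_injective` — the space-time points embed in the dual product torus `(ℤ/2M)¹ × (ℤ/L)²`; `hubbardPlaneWave_one_eq_phase_mul_pchar`,
  `hubbardPlaneWave_zero_eq_phase_mul_pchar` — an annihilator's plane wave `e^{+ik·x}` is a unimodular, momentum-INDEPENDENT time phase `u(x₀)` times the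
  product character `χ̄_{k̄}(x̄)`, a creator's `e^{-ik·x}` is `conj u(x₀)·χ̄_{k̄}(−x̄)` (the half-integer offset of the fermionic frequencies,
  `HubbardSpaceTimeCharacters.exp_matsubara_phase_eq`);
* §2 `sum_tuple4_freqMomentum_eq` (a sum over `4`-tuples of frequency–momenta of a function of their torus images is a fourfold torus sum);
  **`sectorisedKernel_trivial_eq_pairTransfer_of_conserving`** — if for the spins `σ` and charges `(0,0,1,1)` the degree-4 kernel of `G` reads
  `kernel ℂ G 4 ((k_i,σ_i),c_i) = κ·[k̄₀ + k̄₁ = k̄₂ + k̄₃]·f(k̄₀ + k̄₁)` (conservation and dependence on the transfer through the torus images `k̄`), then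
  `sectorisedKernel L M β trivialMultiplier G 4 ((0,σ_i),c_i) x = conj u(x₀⁰)·conj u(x₀¹)·u(x₀²)·u(x₀³)·κ·[x₁ = x₀][x₃ = x₂]·(2M·L²)²·Σ_Q χ̄_Q(x̄₀ − x̄₂) f(−Q)`;
  **`norm_sectorisedKernel_trivial_le_pairTransfer_of_conserving`** — hence the HYPOTHESIS `hB` of (T2) holds with EQUALITY:
  `‖…‖ ≤ [x₁ = x₀][x₃ = x₂]·(‖κ‖(2M·L²)²)·‖Σ_Q χ̄_Q(x̄₀ − x̄₂)•f(−Q)‖`.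
So a producer of the pair-transfer representation may state it in momentum space (amplitudes × conserving transfer bumps + remainder); the Fourier bookkeeping
((s3)-generic) is this file.  Everything is proved; no definitions, no named facts; the hypothesis on `kernel ℂ G 4` is NOT asserted for any engine object;
nothing here asserts (X).1, a branch, K3 or superconductivity. [folklore]  References: BGM 2006 §2.1 (2.2)–(2.5), §2.3 (2.17) [cite: BenfattoGiulianiMastropietro2006];
Salmhofer 1999 §4.2.4 (4.55)–(4.63).
-/

noncomputable section

namespace Summit.HubbardSuperconductivity.HubbardSuperconductivity.Theorems.TorusFourierL2

set_option linter.dupNamespace false -- summit = problem name (single-conjunct summit), D-0017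

open Finset Complex Literature.Probability.LatticeModels Literature.MathematicalPhysics.QuantumLattice
open Literature.MathematicalPhysics.QuantumLattice.GrassmannAlgebra
open Summit.HubbardSuperconductivity.HubbardSuperconductivity.Theorems.KLRegimeSplit
open scoped Real ComplexConjugate

variable {L M : ℕ} [NeZero L] [NeZero M]

/-! ### §1 The dictionary: space-time points and plane waves on the dual product torus -/

omit [NeZero L] in
/-- The embedding `x ↦ x̄ = (x₀ mod 2M, x⃗)` of the space-time points into `(ℤ/2M)¹ × (ℤ/L)²` is injective. [folklore] -/
theorem xbar_injective : Function.Injective (fun x : SpaceTimeIdx L M =>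
    (((fun _ : Fin 1 => ((x.1 : ℕ) : ZMod (2 * M))), x.2) : TorusSite 1 (2 * M) × TorusSite 2 L)) := by
  intro x y h
  have h1 := congr_fun (congr_arg Prod.fst h) 0
  have h2 := congr_arg Prod.snd h
  simp only at h1 h2
  refine Prod.ext ?_ h2
  have hv := congr_arg ZMod.val h1
  rwa [val_natCast_matsubaraIdx, val_natCast_matsubaraIdx, ← Fin.ext_iff] at hv

/-- **An annihilator's plane wave is a time phase times a product character**: for `β ≠ 0`,
`e^{+ik·x} = u(x₀)·χ_{k̄₁}(x̄₀)·χ_{k⃗}(x⃗)` with `u(x₀) = e^{iπ(1−2M)x₀/(2M)}` independent of `k`. [cite: Salmhofer1999, §4.2.4 (4.55)–(4.63)] -/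
theorem hubbardPlaneWave_one_eq_phase_mul_pchar {β : ℝ} (hβ : β ≠ 0) (k : FreqMomentum L M) (x : SpaceTimeIdx L M) :
    hubbardPlaneWave L M β 1 k x =
      Complex.exp (((π * (1 - 2 * M) * ((x.1 : ℕ) : ℝ) / (2 * M) : ℝ) : ℂ) * I) *
        (torusChar (fun _ : Fin 1 => ((k.1 : ℕ) : ZMod (2 * M))) (fun _ : Fin 1 => ((x.1 : ℕ) : ZMod (2 * M))) * torusChar k.2 x.2) := by
  haveI : NeZero (2 * M) := ⟨by have := NeZero.ne M; omega⟩
  have hs : chargeSign 1 = -1 := by simp [chargeSign]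
  rw [hubbardPlaneWave, hs, spaceTimePhase]
  have hexp : -(((-1 : ℝ) * (matsubaraFreq β M k.1 * imagTime β M x.1 + ∑ i, latticeMomentum L k.2 i * ((x.2 i).val : ℝ)) : ℝ) : ℂ) * I =
      ((matsubaraFreq β M k.1 * (imagTime β M x.1 - imagTime β M (0 : ImagTimeIdx M)) : ℝ) : ℂ) * I +
        ((∑ i, latticeMomentum L k.2 i * ((x.2 i).val : ℝ) : ℝ) : ℂ) * I := by
    have h0 : imagTime β M (0 : ImagTimeIdx M) = 0 := by simp [imagTime]
    rw [h0, sub_zero]; push_cast; ring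
  rw [hexp, Complex.exp_add, exp_matsubara_phase_eq hβ k.1 x.1 0, cexp_sum_latticeMomentum_mul_eq_torusChar]
  have hz : (((0 : ImagTimeIdx M) : ℕ) : ZMod (2 * M)) = 0 := by simp
  have hz' : (((0 : ImagTimeIdx M) : ℕ) : ℝ) = 0 := by simp
  rw [hz, hz', sub_zero, sub_zero]
  ring

/-- **A creator's plane wave** `e^{-ik·x} = conj u(x₀)·χ_{k̄₁}(−x̄₀)·χ_{k⃗}(−x⃗)` (`β ≠ 0`). [cite: Salmhofer1999, §4.2.4 (4.55)–(4.63)] -/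
theorem hubbardPlaneWave_zero_eq_phase_mul_pchar {β : ℝ} (hβ : β ≠ 0) (k : FreqMomentum L M) (x : SpaceTimeIdx L M) :
    hubbardPlaneWave L M β 0 k x =
      conj (Complex.exp (((π * (1 - 2 * M) * ((x.1 : ℕ) : ℝ) / (2 * M) : ℝ) : ℂ) * I)) *
        (torusChar (fun _ : Fin 1 => ((k.1 : ℕ) : ZMod (2 * M))) (-(fun _ : Fin 1 => ((x.1 : ℕ) : ZMod (2 * M)))) * torusChar k.2 (-x.2)) := by
  have hconj : hubbardPlaneWave L M β 0 k x = conj (hubbardPlaneWave L M β 1 k x) := by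
    simp only [hubbardPlaneWave, chargeSign, if_true, show (1 : Fin 2) ≠ 0 by decide, if_false, ← Complex.exp_conj, map_mul, map_neg,
      Complex.conj_ofReal, Complex.conj_I]
    congr 1; push_cast; ring
  rw [hconj, hubbardPlaneWave_one_eq_phase_mul_pchar hβ, map_mul, map_mul, ← torusChar_neg_right, ← torusChar_neg_right]

/-! ### §2 Conserving transfer-only momentum kernels have pair-transfer position kernels -/

omit [NeZero L] in
/-- A sum over `4`-tuples of frequency–momenta of a function of their torus images is a fourfold sum over the product torus. [folklore] -/
theorem sum_tuple4_freqMomentum_eq [NeZero L] (F : (TorusSite 1 (2 * M) × TorusSite 2 L) → (TorusSite 1 (2 * M) × TorusSite 2 L) → (TorusSite 1 (2 * M) × TorusSite 2 L) → (TorusSite 1 (2 * M) × TorusSite 2 L) → ℂ) :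
    ∑ k : Fin 4 → FreqMomentum L M, F ((fun _ : Fin 1 => ((((k 0).1 : ℕ) : ZMod (2 * M)))), (k 0).2) ((fun _ : Fin 1 => ((((k 1).1 : ℕ) : ZMod (2 * M)))), (k 1).2) ((fun _ : Fin 1 => ((((k 2).1 : ℕ) : ZMod (2 * M)))), (k 2).2) ((fun _ : Fin 1 => ((((k 3).1 : ℕ) : ZMod (2 * M)))), (k 3).2) =
      ∑ p₀ : TorusSite 1 (2 * M) × TorusSite 2 L, ∑ p₁ : TorusSite 1 (2 * M) × TorusSite 2 L, ∑ p₂ : TorusSite 1 (2 * M) × TorusSite 2 L, ∑ p₃ : TorusSite 1 (2 * M) × TorusSite 2 L, F p₀ p₁ p₂ p₃ := by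
  rw [sum_tuple_succ]
  have h1 : ∀ (X : FreqMomentum L M) (W : Fin 3 → FreqMomentum L M),
      F ((fun _ : Fin 1 => ((((Fin.cons X W : Fin 4 → FreqMomentum L M) 0).1 : ℕ) : ZMod (2 * M))), ((Fin.cons X W : Fin 4 → FreqMomentum L M) 0).2)
        ((fun _ : Fin 1 => ((((Fin.cons X W : Fin 4 → FreqMomentum L M) 1).1 : ℕ) : ZMod (2 * M))), ((Fin.cons X W : Fin 4 → FreqMomentum L M) 1).2)
        ((fun _ : Fin 1 => ((((Fin.cons X W : Fin 4 → FreqMomentum L M) 2).1 : ℕ) : ZMod (2 * M))), ((Fin.cons X W : Fin 4 → FreqMomentum L M) 2).2)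
        ((fun _ : Fin 1 => ((((Fin.cons X W : Fin 4 → FreqMomentum L M) 3).1 : ℕ) : ZMod (2 * M))), ((Fin.cons X W : Fin 4 → FreqMomentum L M) 3).2) =
      F ((fun _ : Fin 1 => ((X.1 : ℕ) : ZMod (2 * M))), X.2) ((fun _ : Fin 1 => (((W 0).1 : ℕ) : ZMod (2 * M))), (W 0).2)
        ((fun _ : Fin 1 => (((W 1).1 : ℕ) : ZMod (2 * M))), (W 1).2) ((fun _ : Fin 1 => (((W 2).1 : ℕ) : ZMod (2 * M))), (W 2).2) := fun _ _ => rfl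
  rw [sum_congr rfl fun X _ => sum_congr rfl fun W _ => h1 X W]
  have h2 : ∀ X : FreqMomentum L M, ∑ W : Fin 3 → FreqMomentum L M,
      F ((fun _ : Fin 1 => ((X.1 : ℕ) : ZMod (2 * M))), X.2) ((fun _ : Fin 1 => (((W 0).1 : ℕ) : ZMod (2 * M))), (W 0).2)
        ((fun _ : Fin 1 => (((W 1).1 : ℕ) : ZMod (2 * M))), (W 1).2) ((fun _ : Fin 1 => (((W 2).1 : ℕ) : ZMod (2 * M))), (W 2).2) =
      ∑ X₁ : FreqMomentum L M, ∑ X₂ : FreqMomentum L M, ∑ X₃ : FreqMomentum L M,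
        F ((fun _ : Fin 1 => ((X.1 : ℕ) : ZMod (2 * M))), X.2) ((fun _ : Fin 1 => ((X₁.1 : ℕ) : ZMod (2 * M))), X₁.2)
          ((fun _ : Fin 1 => ((X₂.1 : ℕ) : ZMod (2 * M))), X₂.2) ((fun _ : Fin 1 => ((X₃.1 : ℕ) : ZMod (2 * M))), X₃.2) := by
    intro X
    rw [sum_tuple_succ]
    refine sum_congr rfl fun X₁ _ => ?_
    rw [sum_tuple_succ]
    refine sum_congr rfl fun X₂ _ => ?_
    rw [sum_tuple_one]
    exact sum_congr rfl fun w _ => rfl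
  simp_rw [h2]
  -- each sum over frequency–momenta is a sum over the product torus (innermost first)
  have e3 : ∀ a b c : TorusSite 1 (2 * M) × TorusSite 2 L, ∑ X₃ : FreqMomentum L M, F a b c ((fun _ : Fin 1 => ((X₃.1 : ℕ) : ZMod (2 * M))), X₃.2) = ∑ p₃ : TorusSite 1 (2 * M) × TorusSite 2 L, F a b c p₃ :=
    fun a b c => sum_freqMomentum_eq_sum_prodTorus (F a b c)
  have e2 : ∀ a b : TorusSite 1 (2 * M) × TorusSite 2 L, ∑ X₂ : FreqMomentum L M, ∑ p₃ : TorusSite 1 (2 * M) × TorusSite 2 L, F a b ((fun _ : Fin 1 => ((X₂.1 : ℕ) : ZMod (2 * M))), X₂.2) p₃ =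
      ∑ p₂ : TorusSite 1 (2 * M) × TorusSite 2 L, ∑ p₃ : TorusSite 1 (2 * M) × TorusSite 2 L, F a b p₂ p₃ :=
    fun a b => sum_freqMomentum_eq_sum_prodTorus (fun p₂ => ∑ p₃ : TorusSite 1 (2 * M) × TorusSite 2 L, F a b p₂ p₃)
  have e1 : ∀ a : TorusSite 1 (2 * M) × TorusSite 2 L, ∑ X₁ : FreqMomentum L M, ∑ p₂ : TorusSite 1 (2 * M) × TorusSite 2 L, ∑ p₃ : TorusSite 1 (2 * M) × TorusSite 2 L, F a ((fun _ : Fin 1 => ((X₁.1 : ℕ) : ZMod (2 * M))), X₁.2) p₂ p₃ =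
      ∑ p₁ : TorusSite 1 (2 * M) × TorusSite 2 L, ∑ p₂ : TorusSite 1 (2 * M) × TorusSite 2 L, ∑ p₃ : TorusSite 1 (2 * M) × TorusSite 2 L, F a p₁ p₂ p₃ :=
    fun a => sum_freqMomentum_eq_sum_prodTorus (fun p₁ => ∑ p₂ : TorusSite 1 (2 * M) × TorusSite 2 L, ∑ p₃ : TorusSite 1 (2 * M) × TorusSite 2 L, F a p₁ p₂ p₃)
  simp_rw [e3, e2, e1]
  exact sum_freqMomentum_eq_sum_prodTorus (fun p₀ => ∑ p₁ : TorusSite 1 (2 * M) × TorusSite 2 L, ∑ p₂ : TorusSite 1 (2 * M) × TorusSite 2 L, ∑ p₃ : TorusSite 1 (2 * M) × TorusSite 2 L, F p₀ p₁ p₂ p₃)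

/-- **The position kernel of a conserving transfer-only quartic is a pair-transfer form** (charges `(+,+,−,−)`; see the module docstring).
[cite: BenfattoGiulianiMastropietro2006, §2.3 (2.17)] -/
theorem sectorisedKernel_trivial_eq_pairTransfer_of_conserving {β : ℝ} (hβ : β ≠ 0) (G : HubbardGrassmann L M) (σ : Fin 4 → Fin 2)
    (κ : ℂ) (f : TorusSite 1 (2 * M) × TorusSite 2 L → ℂ)
    (hker : ∀ k : Fin 4 → FreqMomentum L M,
      kernel ℂ G 4 (fun i => ((k i, σ i), (![0, 0, 1, 1] : Fin 4 → Fin 2) i)) = κ * (if ((fun _ : Fin 1 => ((((k 0).1 : ℕ) : ZMod (2 * M)))), (k 0).2) + ((fun _ : Fin 1 => ((((k 1).1 : ℕ) : ZMod (2 * M)))), (k 1).2) = (((fun _ : Fin 1 => ((((k 2).1 : ℕ) : ZMod (2 * M)))), (k 2).2) : TorusSite 1 (2 * M) × TorusSite 2 L) + ((fun _ : Fin 1 => ((((k 3).1 : ℕ) : ZMod (2 * M)))), (k 3).2) then f (((fun _ : Fin 1 => ((((k 0).1 : ℕ) : ZMod (2 * M)))), (k 0).2) + ((fun _ : Fin 1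 => ((((k 1).1 : ℕ) : ZMod (2 * M)))), (k 1).2)) else 0))
    (x : Fin 4 → SpaceTimeIdx L M) :
    sectorisedKernel L M β (trivialMultiplier L M) G 4 (fun i => (((0 : Fin 1), σ i), (![0, 0, 1, 1] : Fin 4 → Fin 2) i)) x =
      (conj (Complex.exp (((π * (1 - 2 * M) * (((x 0).1 : ℕ) : ℝ) / (2 * M) : ℝ) : ℂ) * I)) * conj (Complex.exp (((π * (1 - 2 * M) * (((x 1).1 : ℕ) : ℝ) / (2 * M) : ℝ) : ℂ) * I)) * Complex.exp (((π * (1 - 2 * M) * (((x 2).1 : ℕ) : ℝ) / (2 * M) : ℝ) : ℂ) * I) * Complex.exp (((π * (1 - 2 * M) * (((x 3).1 : ℕ) : ℝ) / (2 * M) : ℝ) : ℂ) * I) * κ) *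
        (if x 1 = x 0 ∧ x 3 = x 2 then ((((2 * M : ℕ) : ℂ) * (L : ℂ) ^ 2) ^ 2) *
          ∑ Q : TorusSite 1 (2 * M) × TorusSite 2 L, (torusChar (Q).1 ((((fun _ : Fin 1 => ((((x 0).1 : ℕ) : ZMod (2 * M)))), (x 0).2) : TorusSite 1 (2 * M) × TorusSite 2 L) - (((fun _ : Fin 1 => ((((x 2).1 : ℕ) : ZMod (2 * M)))), (x 2).2) : TorusSite 1 (2 * M) × TorusSite 2 L)).1 * torusChar (Q).2 ((((fun _ : Fin 1 => ((((x 0).1 : ℕ) : ZMod (2 * M)))), (x 0).2) : TorusSite 1 (2 * M) × TorusSite 2 L) - (((fun _ : Fin 1 => ((((x 2).1 : ℕ) : ZMod (2 * M)))), (x 2).2) : TorusSite 1 (2 * M) × TorusSite 2 L)).2) * f (-Q) else 0) := by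
  classical
  -- (1) the summand, leg by leg
  have hk' : ∀ k : Fin 4 → FreqMomentum L M,
      kernel ℂ G 4 (fun i => ((k i, ((fun i : Fin 4 => ((((0 : Fin 1), σ i) : Fin 1 × Fin 2), (![0, 0, 1, 1] : Fin 4 → Fin 2) i)) i).1.2),
        ((fun i : Fin 4 => ((((0 : Fin 1), σ i) : Fin 1 × Fin 2), (![0, 0, 1, 1] : Fin 4 → Fin 2) i)) i).2)) =
      kernel ℂ G 4 (fun i => ((k i, σ i), (![0, 0, 1, 1] : Fin 4 → Fin 2) i)) := fun k => rfl
  have ht : ∀ (ω : Fin 1) (q : FreqMomentum L M), trivialMultiplier L M ω q = 1 := fun _ _ => rfl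
  have hterm : ∀ k : Fin 4 → FreqMomentum L M,
      (∏ i, trivialMultiplier L M ((fun i : Fin 4 => ((((0 : Fin 1), σ i) : Fin 1 × Fin 2), (![0, 0, 1, 1] : Fin 4 → Fin 2) i)) i).1.1 (k i) *
          hubbardPlaneWave L M β ((fun i : Fin 4 => ((((0 : Fin 1), σ i) : Fin 1 × Fin 2), (![0, 0, 1, 1] : Fin 4 → Fin 2) i)) i).2 (k i) (x i)) *
        kernel ℂ G 4 (fun i => ((k i, ((fun i : Fin 4 => ((((0 : Fin 1), σ i) : Fin 1 × Fin 2), (![0, 0, 1, 1] : Fin 4 → Fin 2) i)) i).1.2),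
          ((fun i : Fin 4 => ((((0 : Fin 1), σ i) : Fin 1 × Fin 2), (![0, 0, 1, 1] : Fin 4 → Fin 2) i)) i).2)) =
      (conj (Complex.exp (((π * (1 - 2 * M) * (((x 0).1 : ℕ) : ℝ) / (2 * M) : ℝ) : ℂ) * I)) * conj (Complex.exp (((π * (1 - 2 * M) * (((x 1).1 : ℕ) : ℝ) / (2 * M) : ℝ) : ℂ) * I)) * Complex.exp (((π * (1 - 2 * M) * (((x 2).1 : ℕ) : ℝ) / (2 * M) : ℝ) : ℂ) * I) * Complex.exp (((π * (1 - 2 * M) * (((x 3).1 : ℕ) : ℝ) / (2 * M) : ℝ) : ℂ) * I) * κ) * ((torusChar (((fun _ : Fin 1 => ((((k 0).1 : ℕ) : ZMod (2 * M)))), (k 0).2)).1 (-(((fun _ : Fin 1 => ((((x 0).1 : ℕ) : ZMod (2 * M)))), (x 0).2) : TorusSite 1 (2 * M) × TorusSite 2 L)).1 * torusChar (((fun _ : Fin 1 => ((((k 0).1 : ℕ) : ZMod (2 * M)))), (k 0).2)).2 (-(((fun _ : Fin 1 => ((((x 0).1 : ℕ) : ZMod (2 * M)))), (x 0).2) : TorusSite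 1 (2 * M) × TorusSite 2 L)).2) * (torusChar (((fun _ : Fin 1 => ((((k 1).1 : ℕ) : ZMod (2 * M)))), (k 1).2)).1 (-(((fun _ : Fin 1 => ((((x 1).1 : ℕ) : ZMod (2 * M)))), (x 1).2) : TorusSite 1 (2 * M) × TorusSite 2 L)).1 * torusChar (((fun _ : Fin 1 => ((((k 1).1 : ℕ) : ZMod (2 * M)))), (k 1).2)).2 (-(((fun _ : Fin 1 => ((((x 1).1 : ℕ) : ZMod (2 * M)))), (x 1).2) : TorusSite 1 (2 * M) × TorusSite 2 L)).2) * (torusChar (((fun _ : Fin 1 => ((((k 2).1 : ℕ) : ZMod (2 * M)))), (k 2).2)).1 ((((fun _ : Fin 1 => ((((x 2).1 : ℕ) : ZMod (2 * M)))), (x 2).2) : TorusSite 1 (2 * M) × TorusSite 2 L)).1 * torusChar (((fun _ : Fin 1 => ((((k 2).1 : ℕ) : ZMod (2 * M)))), (k 2).2)).2 ((((fun _ : Fin 1 => ((((x 2).1 : ℕ) : ZMod (2 * M)))), (x 2).2) : TorusSite 1 (2 * M) × TorusSite 2 L)).2) * (torusChar (((fun _ : Fin 1 => ((((k 3).1 :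 ℕ) : ZMod (2 * M)))), (k 3).2)).1 ((((fun _ : Fin 1 => ((((x 3).1 : ℕ) : ZMod (2 * M)))), (x 3).2) : TorusSite 1 (2 * M) × TorusSite 2 L)).1 * torusChar (((fun _ : Fin 1 => ((((k 3).1 : ℕ) : ZMod (2 * M)))), (k 3).2)).2 ((((fun _ : Fin 1 => ((((x 3).1 : ℕ) : ZMod (2 * M)))), (x 3).2) : TorusSite 1 (2 * M) × TorusSite 2 L)).2) * (if ((fun _ : Fin 1 => ((((k 0).1 : ℕ) : ZMod (2 * M)))), (k 0).2) + ((fun _ : Fin 1 => ((((k 1).1 : ℕ) : ZMod (2 * M)))), (k 1).2) = (((fun _ : Fin 1 => ((((k 2).1 : ℕ) : ZMod (2 * M)))), (k 2).2) : TorusSite 1 (2 * M) × TorusSite 2 L) + ((fun _ : Fin 1 => ((((k 3).1 : ℕ) : ZMod (2 * M)))), (k 3).2) then f (((fun _ : Fin 1 => ((((k 0).1 : ℕ) : ZMod (2 * M)))), (k 0).2) + ((fun _ : Fin 1 => ((((k 1).1 : ℕ) : ZMod (2 * M)))), (k 1).2)) else 0)) := by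
    intro k
    rw [hk', hker k, Fin.prod_univ_four]
    simp only [ht, one_mul]
    show hubbardPlaneWave L M β 0 (k 0) (x 0) * hubbardPlaneWave L M β 0 (k 1) (x 1) * hubbardPlaneWave L M β 1 (k 2) (x 2) *
        hubbardPlaneWave L M β 1 (k 3) (x 3) * (κ * (if ((fun _ : Fin 1 => ((((k 0).1 : ℕ) : ZMod (2 * M)))), (k 0).2) + ((fun _ : Fin 1 => ((((k 1).1 : ℕ) : ZMod (2 * M)))), (k 1).2) = (((fun _ : Fin 1 => ((((k 2).1 : ℕ) : ZMod (2 * M)))), (k 2).2) : TorusSite 1 (2 * M) × TorusSite 2 L) + ((fun _ : Fin 1 => ((((k 3).1 : ℕ) : ZMod (2 * M)))), (k 3).2) then f (((fun _ : Fin 1 => ((((k 0).1 : ℕ) : ZMod (2 * M)))), (k 0).2) + ((fun _ : Fin 1 => ((((k 1).1 : ℕ) : ZMod (2 * M)))), (k 1).2)) else 0)) = _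
    rw [hubbardPlaneWave_zero_eq_phase_mul_pchar hβ, hubbardPlaneWave_zero_eq_phase_mul_pchar hβ,
      hubbardPlaneWave_one_eq_phase_mul_pchar hβ, hubbardPlaneWave_one_eq_phase_mul_pchar hβ]
    simp only [Prod.fst_neg, Prod.snd_neg]
    ring
  rw [sectorisedKernel_def]
  simp_rw [hterm]
  rw [← mul_sum]
  -- (2) the fourfold sum over frequency–momenta → over the product torus, then (T5a)
  have hsum4 : ∑ k : Fin 4 → FreqMomentum L M, (torusChar (((fun _ : Fin 1 => ((((k 0).1 : ℕ) : ZMod (2 * M)))), (k 0).2)).1 (-(((fun _ : Fin 1 => ((((x 0).1 : ℕ) : ZMod (2 * M)))), (x 0).2) : TorusSite 1 (2 * M) × TorusSite 2 L)).1 * torusChar (((fun _ : Fin 1 => ((((k 0).1 : ℕ) : ZMod (2 * M)))), (k 0).2)).2 (-(((fun _ : Fin 1 => ((((x 0).1 : ℕ) : ZMod (2 * M)))), (x 0).2) : TorusSite 1 (2 * M) × TorusSite 2 L)).2) * (torusChar (((fun _ : Fin 1 => ((((k 1).1 : ℕ) : ZMod (2 * M)))), (k 1).2)).1 (-(((fun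 _ : Fin 1 => ((((x 1).1 : ℕ) : ZMod (2 * M)))), (x 1).2) : TorusSite 1 (2 * M) × TorusSite 2 L)).1 * torusChar (((fun _ : Fin 1 => ((((k 1).1 : ℕ) : ZMod (2 * M)))), (k 1).2)).2 (-(((fun _ : Fin 1 => ((((x 1).1 : ℕ) : ZMod (2 * M)))), (x 1).2) : TorusSite 1 (2 * M) × TorusSite 2 L)).2) * (torusChar (((fun _ : Fin 1 => ((((k 2).1 : ℕ) : ZMod (2 * M)))), (k 2).2)).1 ((((fun _ : Fin 1 => ((((x 2).1 : ℕ) : ZMod (2 * M)))), (x 2).2) : TorusSite 1 (2 * M) × TorusSite 2 L)).1 * torusChar (((fun _ : Fin 1 => ((((k 2).1 : ℕ) : ZMod (2 * M)))), (k 2).2)).2 ((((fun _ : Fin 1 => ((((x 2).1 : ℕ) : ZMod (2 * M)))), (x 2).2) : TorusSite 1 (2 * M) × TorusSite 2 L)).2) * (torusChar (((fun _ : Fin 1 => ((((k 3).1 : ℕ) : ZMod (2 * M)))), (k 3).2)).1 ((((fun _ : Fin 1 => ((((x 3).1 : ℕ) : ZMod (2 * M)))), (x 3).2) : TorusSite 1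 (2 * M) × TorusSite 2 L)).1 * torusChar (((fun _ : Fin 1 => ((((k 3).1 : ℕ) : ZMod (2 * M)))), (k 3).2)).2 ((((fun _ : Fin 1 => ((((x 3).1 : ℕ) : ZMod (2 * M)))), (x 3).2) : TorusSite 1 (2 * M) × TorusSite 2 L)).2) * (if ((fun _ : Fin 1 => ((((k 0).1 : ℕ) : ZMod (2 * M)))), (k 0).2) + ((fun _ : Fin 1 => ((((k 1).1 : ℕ) : ZMod (2 * M)))), (k 1).2) = (((fun _ : Fin 1 => ((((k 2).1 : ℕ) : ZMod (2 * M)))), (k 2).2) : TorusSite 1 (2 * M) × TorusSite 2 L) + ((fun _ : Fin 1 => ((((k 3).1 : ℕ) : ZMod (2 * M)))), (k 3).2) then f (((fun _ : Fin 1 => ((((k 0).1 : ℕ) : ZMod (2 * M)))), (k 0).2) + ((fun _ : Fin 1 => ((((k 1).1 : ℕ) : ZMod (2 * M)))), (k 1).2)) else 0) =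
      ∑ p₀ : TorusSite 1 (2 * M) × TorusSite 2 L, ∑ p₁ : TorusSite 1 (2 * M) × TorusSite 2 L, ∑ p₂ : TorusSite 1 (2 * M) × TorusSite 2 L, ∑ p₃ : TorusSite 1 (2 * M) × TorusSite 2 L, (torusChar (p₀).1 (-(((fun _ : Fin 1 => ((((x 0).1 : ℕ) : ZMod (2 * M)))), (x 0).2) : TorusSite 1 (2 * M) × TorusSite 2 L)).1 * torusChar (p₀).2 (-(((fun _ : Fin 1 => ((((x 0).1 : ℕ) : ZMod (2 * M)))), (x 0).2) : TorusSite 1 (2 * M) × TorusSite 2 L)).2) * (torusChar (p₁).1 (-(((fun _ : Fin 1 => ((((x 1).1 : ℕ) : ZMod (2 * M)))), (x 1).2) : TorusSite 1 (2 * M) × TorusSite 2 L)).1 * torusChar (p₁).2 (-(((fun _ : Fin 1 => ((((x 1).1 : ℕ) : ZMod (2 * M)))), (x 1).2) : TorusSite 1 (2 * M) × TorusSite 2 L)).2) * (torusChar (p₂).1 ((((fun _ : Fin 1 => ((((x 2).1 : ℕ) : ZMod (2 * M)))), (x 2).2) : TorusSite 1 (2 * M) × TorusSite 2 L)).1 *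 torusChar (p₂).2 ((((fun _ : Fin 1 => ((((x 2).1 : ℕ) : ZMod (2 * M)))), (x 2).2) : TorusSite 1 (2 * M) × TorusSite 2 L)).2) * (torusChar (p₃).1 ((((fun _ : Fin 1 => ((((x 3).1 : ℕ) : ZMod (2 * M)))), (x 3).2) : TorusSite 1 (2 * M) × TorusSite 2 L)).1 * torusChar (p₃).2 ((((fun _ : Fin 1 => ((((x 3).1 : ℕ) : ZMod (2 * M)))), (x 3).2) : TorusSite 1 (2 * M) × TorusSite 2 L)).2) * (if p₀ + p₁ = p₂ + p₃ then f (p₀ + p₁) else 0) :=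
    sum_tuple4_freqMomentum_eq (fun p₀ p₁ p₂ p₃ => (torusChar (p₀).1 (-(((fun _ : Fin 1 => ((((x 0).1 : ℕ) : ZMod (2 * M)))), (x 0).2) : TorusSite 1 (2 * M) × TorusSite 2 L)).1 * torusChar (p₀).2 (-(((fun _ : Fin 1 => ((((x 0).1 : ℕ) : ZMod (2 * M)))), (x 0).2) : TorusSite 1 (2 * M) × TorusSite 2 L)).2) * (torusChar (p₁).1 (-(((fun _ : Fin 1 => ((((x 1).1 : ℕ) : ZMod (2 * M)))), (x 1).2) : TorusSite 1 (2 * M) × TorusSite 2 L)).1 * torusChar (p₁).2 (-(((fun _ : Fin 1 => ((((x 1).1 : ℕ) : ZMod (2 * M)))), (x 1).2) : TorusSite 1 (2 * M) × TorusSite 2 L)).2) * (torusChar (p₂).1 ((((fun _ : Fin 1 => ((((x 2).1 : ℕ) : ZMod (2 * M)))), (x 2).2) : TorusSite 1 (2 * M) × TorusSite 2 L)).1 * torusChar (p₂).2 ((((fun _ : Fin 1 => ((((x 2).1 : ℕ) : ZMod (2 * M)))), (x 2).2) : TorusSite 1 (2 * M) × TorusSite 2 L)).2) * (torusChar (p₃).1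 ((((fun _ : Fin 1 => ((((x 3).1 : ℕ) : ZMod (2 * M)))), (x 3).2) : TorusSite 1 (2 * M) × TorusSite 2 L)).1 * torusChar (p₃).2 ((((fun _ : Fin 1 => ((((x 3).1 : ℕ) : ZMod (2 * M)))), (x 3).2) : TorusSite 1 (2 * M) × TorusSite 2 L)).2) * (if p₀ + p₁ = p₂ + p₃ then f (p₀ + p₁) else 0))
  rw [hsum4, fourLeg_transfer_charSum_eq f (((fun _ : Fin 1 => ((((x 0).1 : ℕ) : ZMod (2 * M)))), (x 0).2) : TorusSite 1 (2 * M) × TorusSite 2 L) (((fun _ : Fin 1 => ((((x 1).1 : ℕ) : ZMod (2 * M)))), (x 1).2) : TorusSite 1 (2 * M) × TorusSite 2 L) (((fun _ : Fin 1 => ((((x 2).1 : ℕ) : ZMod (2 * M)))), (x 2).2) : TorusSite 1 (2 * M) × TorusSite 2 L) (((fun _ : Fin 1 => ((((x 3).1 : ℕ) : ZMod (2 * M)))), (x 3).2) : TorusSite 1 (2 * M) × TorusSite 2 L)]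
  -- (3) the indicator on torus images is the indicator on space-time points
  congr 1
  refine if_congr ⟨fun h => ⟨xbar_injective h.1, xbar_injective h.2⟩, fun h => ?_⟩ rfl rfl
  rw [h.1, h.2]; exact ⟨rfl, rfl⟩

/-- **Hence the hypothesis `hB` of (T2) with equality**: under the kernel hypothesis of `sectorisedKernel_trivial_eq_pairTransfer_of_conserving`,
`‖W Ω x‖ ≤ [x₁ = x₀][x₃ = x₂]·(‖κ‖·(2M·L²)²)·‖Σ_Q χ̄_Q(x̄₀ − x̄₂)•f(−Q)‖` (pairing `{0,1}{2,3}`, symbol `Q ↦ f(−Q)`). [cite: BenfattoGiulianiMastropietro2006, §2.3 (2.17)] -/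
theorem norm_sectorisedKernel_trivial_le_pairTransfer_of_conserving {β : ℝ} (hβ : β ≠ 0) (G : HubbardGrassmann L M) (σ : Fin 4 → Fin 2)
    (κ : ℂ) (f : TorusSite 1 (2 * M) × TorusSite 2 L → ℂ)
    (hker : ∀ k : Fin 4 → FreqMomentum L M,
      kernel ℂ G 4 (fun i => ((k i, σ i), (![0, 0, 1, 1] : Fin 4 → Fin 2) i)) = κ * (if ((fun _ : Fin 1 => ((((k 0).1 : ℕ) : ZMod (2 * M)))), (k 0).2) + ((fun _ : Fin 1 => ((((k 1).1 : ℕ) : ZMod (2 * M)))), (k 1).2) = (((fun _ : Fin 1 => ((((k 2).1 : ℕ) : ZMod (2 * M)))), (k 2).2) : TorusSite 1 (2 * M) × TorusSite 2 L) + ((fun _ : Fin 1 => ((((k 3).1 : ℕ) : ZMod (2 * M)))), (k 3).2) then f (((fun _ : Fin 1 => ((((k 0).1 : ℕ) : ZMod (2 * M)))), (k 0).2) + ((fun _ : Fin 1 => ((((k 1).1 : ℕ) : ZMod (2 * M)))), (k 1).2)) else 0))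
    (x : Fin 4 → SpaceTimeIdx L M) :
    ‖sectorisedKernel L M β (trivialMultiplier L M) G 4 (fun i => (((0 : Fin 1), σ i), (![0, 0, 1, 1] : Fin 4 → Fin 2) i)) x‖ ≤
      if x 1 = x 0 ∧ x 3 = x 2 then (‖κ‖ * ((((2 * M : ℕ) : ℝ) * (L : ℝ) ^ 2) ^ 2)) * ‖∑ Q : TorusSite 1 (2 * M) × TorusSite 2 L,
        (torusChar Q.1 (fun _ : Fin 1 => (((x 0).1 : ℕ) : ZMod (2 * M)) - (((x 2).1 : ℕ) : ZMod (2 * M))) *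
          torusChar Q.2 ((x 0).2 - (x 2).2)) • (fun Q => f (-Q)) Q‖ else 0 := by
  rw [sectorisedKernel_trivial_eq_pairTransfer_of_conserving hβ G σ κ f hker x]
  have hu : ∀ i : Fin 4, ‖Complex.exp (((π * (1 - 2 * M) * (((x i).1 : ℕ) : ℝ) / (2 * M) : ℝ) : ℂ) * I)‖ = 1 := fun i => Complex.norm_exp_ofReal_mul_I _
  by_cases hx : x 1 = x 0 ∧ x 3 = x 2
  · rw [if_pos hx, if_pos hx, norm_mul, norm_mul, norm_mul, norm_mul, norm_mul, norm_mul, Complex.norm_conj, Complex.norm_conj, hu 0, hu 1, hu 2, hu 3,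
      norm_pow, norm_mul, Complex.norm_natCast, norm_pow, Complex.norm_natCast]
    refine le_of_eq ?_
    have hsub : ((((fun _ : Fin 1 => ((((x 0).1 : ℕ) : ZMod (2 * M)))), (x 0).2) : TorusSite 1 (2 * M) × TorusSite 2 L) - (((fun _ : Fin 1 => ((((x 2).1 : ℕ) : ZMod (2 * M)))), (x 2).2) : TorusSite 1 (2 * M) × TorusSite 2 L) : TorusSite 1 (2 * M) × TorusSite 2 L) =
        ((fun _ : Fin 1 => (((x 0).1 : ℕ) : ZMod (2 * M)) - (((x 2).1 : ℕ) : ZMod (2 * M))), (x 0).2 - (x 2).2) := rfl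
    rw [hsub]
    simp only [smul_eq_mul]
    ring
  · rw [if_neg hx, if_neg hx, mul_zero, norm_zero]

end Summit.HubbardSuperconductivity.HubbardSuperconductivity.Theorems.TorusFourierL2

end
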